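import Mathlib.RingTheory.Norm.Transitivity
import Mathlib.LinearAlgebra.Determinant
import Mathlib.RingTheory.Complex
import Mathlib.NumberTheory.NumberField.CanonicalEmbedding.Basic
import HarnessLib

/-!
# The algebra norm of a matrix algebra, of a product algebra, and of `K ⊗_ℚ ℝ`

`Literature/RingTheory/Norm` support file (everything proved, no definitions). For a commutative
ring `F`, the regular representation of `M_n(F)` on itself is `n` copies of the standard
representation (one per column), so

* `det_mulLeft_matrix` : `det_F (M ↦ a M) = (det a)^n` on `M_n(F)`;
* `algebraNorm_matrix` : for `F` finite free over a commutative ring `R`,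
  `N_{M_n(F)/R}(a) = N_{F/R}(det a)^n` (transitivity in the form of Mathlib's
  `LinearMap.det_restrictScalars`);
* `algebraNorm_prod_apply`, `algebraNorm_pi_apply` : the norm of a product algebra is the product
  of the norms (Mathlib `LinearMap.det_prodMap`, `LinearMap.det_pi`);
* `abs_algebraNorm_mixedSpace` : on `K_∞ ≅ ℝ^{r₁} × ℂ^{r₂}`
  (`mixedSpace K`) the absolute value of the `ℝ`-algebra norm is Mathlib's
  `NumberField.mixedEmbedding.norm` (`∏_w ‖x_w‖^{[K_w:ℝ]}`), and
  `abs_algebraNorm_matrix_mixedSpace` : `|N_{M_n(K_∞)/ℝ}(a)| = (∏_w ‖det a_w‖^{[K_w:ℝ]})^n`.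

These identify the density `|N_{A/ℝ}(x)|⁻¹` of the Haar measure of `GL_n(K_∞) = M_n(K_∞)ˣ`
(`Literature.MeasureTheory.Group.unitsHaarOfAddHaar`) with `|det x|_∞^{-n}`, the archimedean factor of
the adelic module `|det x|_𝔸^{-n}` (Godement–Jacquet (1972), §8; Weil, *Basic Number Theory*, Ch. I
§2 and Ch. IV §4: module of an idele). Mathlib: `Algebra.norm`, `Algebra.norm_complex_apply`,
`NumberField.mixedEmbedding.norm`; no lemma for the norm of a matrix or of a product algebra
(`lean search 'norm_matrix|norm_prod_apply|norm_pi_apply|det_mulLeft'`: no hits).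

## References

* N. Bourbaki, *Algebra* III §9 (norm of the regular representation) [folklore].
* R. Godement, H. Jacquet, *Zeta functions of simple algebras*, LNM 260 (1972), §8
  [GodementJacquet1972].
-/

noncomputable section

namespace Literature.RingTheory.Norm

/-! ### The regular representation of a matrix algebra -/

section MulLeft

variable {F : Type*} [CommRing F] {ι : Type*} [Fintype ι] [DecidableEq ι]

/-- **`det_F (M ↦ a M) = (det a)^n` on `M_n(F)`**: conjugating by the transpose, left
multiplication by `a` becomes the diagonal action of `a` on the `n` rows of `Mᵀ`, whose
determinant is `∏_j det a` (Mathlib `LinearMap.det_pi`, `LinearMap.det_toLin'`).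
[folklore] -/
theorem det_mulLeft_matrix (a : Matrix ι ι F) :
    LinearMap.det (LinearMap.mulLeft F a) = a.det ^ Fintype.card ι := by
  -- `e M = (j ↦ column j of M)`: transpose, then forget the `Matrix` synonym
  set e : Matrix ι ι F ≃ₗ[F] (ι → ι → F) :=
    (Matrix.transposeLinearEquiv ι ι F F).trans (Matrix.ofLinearEquiv F).symm with he
  have key : (e : Matrix ι ι F →ₗ[F] (ι → ι → F)) ∘ₗ LinearMap.mulLeft F a ∘ₗ
      (e.symm : (ι → ι → F) →ₗ[F] Matrix ι ι F) =
        LinearMap.pi fun j : ι => (Matrix.toLin' a).comp (LinearMap.proj j) := by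
    apply LinearMap.ext
    intro M
    funext j i
    simp [he, Matrix.transposeLinearEquiv, Matrix.transposeAddEquiv, Matrix.mul_apply,
      Matrix.mulVec, dotProduct, mul_comm]
  rw [← LinearMap.det_conj (LinearMap.mulLeft F a) e, key, LinearMap.det_pi]
  simp [LinearMap.det_toLin', Finset.prod_const, Finset.card_univ]

end MulLeft

/-! ### Norm of a matrix algebra over a tower -/

section Tower

variable {R F : Type*} [CommRing R] [CommRing F] [Algebra R F] [Module.Free R F]
  {ι : Type*} [Fintype ι] [DecidableEq ι]

/-- **`N_{M_n(F)/R}(a) = N_{F/R}(det a)^n`** for a commutative `R`-algebra `F` which is a free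
`R`-module: the `R`-linear map `M ↦ a M` is the restriction of scalars of the `F`-linear one, whose
determinant is `(det a)^n` (`det_mulLeft_matrix`), and
`det_R(restrictScalars f) = N_{F/R}(det_F f)` (Mathlib `LinearMap.det_restrictScalars`).
[folklore] -/
theorem algebraNorm_matrix (a : Matrix ι ι F) :
    Algebra.norm R a = Algebra.norm R a.det ^ Fintype.card ι := by
  rw [Algebra.norm_apply]
  have h : (Algebra.lmul R (Matrix ι ι F) a : Matrix ι ι F →ₗ[R] Matrix ι ι F) =
      (LinearMap.mulLeft F a).restrictScalars R := rfl
  rw [h, LinearMap.det_restrictScalars, det_mulLeft_matrix, map_pow]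

end Tower

/-! ### Norm of a product algebra -/

section Prod

variable {R : Type*} [CommRing R]

/-- **The norm of a product algebra is the product of the norms**: for `x = (x₁, x₂) ∈ B × C`,
`N_{(B × C)/R}(x) = N_{B/R}(x₁) N_{C/R}(x₂)` (left multiplication by `x` is the product map;
Mathlib `LinearMap.det_prodMap`). [folklore] -/
theorem algebraNorm_prod_apply {B C : Type*} [Ring B] [Ring C] [Algebra R B] [Algebra R C]
    [Module.Free R B] [Module.Free R C] [Module.Finite R B] [Module.Finite R C] (x : B × C) :
    Algebra.norm R x = Algebra.norm R x.1 * Algebra.norm R x.2 := by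
  rw [Algebra.norm_apply, Algebra.norm_apply, Algebra.norm_apply]
  have h : (Algebra.lmul R (B × C) x : B × C →ₗ[R] B × C) =
      (Algebra.lmul R B x.1 : B →ₗ[R] B).prodMap (Algebra.lmul R C x.2 : C →ₗ[R] C) := by
    apply LinearMap.ext
    intro y
    rfl
  rw [h, LinearMap.det_prodMap]

/-- **The norm of a power algebra is the product of the norms**: for `f ∈ B^ι`,
`N_{B^ι/R}(f) = ∏_i N_{B/R}(f i)` (Mathlib `LinearMap.det_pi`). [folklore] -/
theorem algebraNorm_pi_apply {ι : Type*} [Fintype ι] {B : Type*} [Ring B] [Algebra R B]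
    [Module.Free R B] [Module.Finite R B] (f : ι → B) :
    Algebra.norm R f = ∏ i, Algebra.norm R (f i) := by
  classical
  rw [Algebra.norm_apply]
  have h : (Algebra.lmul R (ι → B) f : (ι → B) →ₗ[R] (ι → B)) =
      LinearMap.pi fun i => (Algebra.lmul R B (f i) : B →ₗ[R] B).comp (LinearMap.proj i) := by
    apply LinearMap.ext
    intro y
    rfl
  rw [h, LinearMap.det_pi]
  rfl

end Prod

/-! ### The mixed space `K_∞ = ℝ^{r₁} × ℂ^{r₂}` of a number field -/

section MixedSpace

open NumberField NumberField.InfinitePlace NumberField.mixedEmbedding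
open scoped Classical

variable (K : Type*) [Field K] [NumberField K]

/-- **`|N_{K_∞/ℝ}(x)| = ∏_w ‖x_w‖^{[K_w : ℝ]}`**: on the mixed space `K_∞ = ℝ^{r₁} × ℂ^{r₂}` the
absolute value of the `ℝ`-algebra norm is Mathlib's `NumberField.mixedEmbedding.norm`
(`N_{ℝ/ℝ}(t) = t`, `N_{ℂ/ℝ}(z) = |z|²`, Mathlib `Algebra.norm_complex_apply`; Weil, *Basic Number
Theory*, Ch. I §2, the module of `ℝ`, `ℂ`). [folklore] -/
theorem abs_algebraNorm_mixedSpace (x : mixedSpace K) :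
    |Algebra.norm ℝ x| = mixedEmbedding.norm x := by
  rw [algebraNorm_prod_apply, algebraNorm_pi_apply, algebraNorm_pi_apply, abs_mul,
    Finset.abs_prod, Finset.abs_prod, mixedEmbedding.norm_apply, prod_eq_prod_mul_prod]
  congr 1
  · refine Finset.prod_congr rfl fun w _ => ?_
    rw [Algebra.norm_self, MonoidHom.id_apply, normAtPlace_apply_of_isReal w.2, mult, if_pos w.2,
      pow_one, Real.norm_eq_abs]
  · refine Finset.prod_congr rfl fun w _ => ?_
    rw [Algebra.norm_complex_apply, normAtPlace_apply_of_isComplex w.2, mult,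
      if_neg (not_isReal_iff_isComplex.2 w.2), Complex.normSq_eq_norm_sq,
      abs_of_nonneg (sq_nonneg _)]

/-- **`|N_{M_n(K_∞)/ℝ}(a)| = |det a|_∞^n`** with `|t|_∞ = ∏_w ‖t_w‖^{[K_w:ℝ]}` the archimedean
module: the density of the Haar measure `|N_{A/ℝ}(x)|⁻¹ dx` of `GL_n(K_∞)`
(`Literature.MeasureTheory.Group.unitsHaarOfAddHaar`) is `|det x|_∞^{-n}` (Godement–Jacquet
(1972), §8: `d^×x = |det x|^{-n} dx` over `ℝ` and `ℂ`). [folklore] -/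
theorem abs_algebraNorm_matrix_mixedSpace {ι : Type*} [Fintype ι] [DecidableEq ι]
    (a : Matrix ι ι (mixedSpace K)) :
    |Algebra.norm ℝ a| = mixedEmbedding.norm a.det ^ Fintype.card ι := by
  rw [algebraNorm_matrix, abs_pow, abs_algebraNorm_mixedSpace]

end MixedSpace

end Literature.RingTheory.Norm
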